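import Literature.NumberTheory.Automorphic.ResGLnKugaCasimirScalarE
import Literature.NumberTheory.Automorphic.GLnCasimirHCPolynomial
import Literature.NumberTheory.DiophantineGeometry.GLHighestWeightFacts
import Literature.NumberTheory.DiophantineGeometry.SchurWeylHighestWeightProofs
import HarnessLib

/-!
# The Casimir scalar of the coefficient module `V_λ(ℂ)` of `GLₙ`: `C^alg = |λ + ρ|² - |ρ|²`

Topic `NumberTheory/Automorphic`; namespaces `Literature.NumberTheory.Automorphic.AlgDiff`
(vocabulary of `GLnAlgebraicDifferential`) and `…ConeDictionary` (vocabulary of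
`ResGLnKugaCasimirScalarE`).  Theorems only; no named fact, no `sorry`.

`GLnAlgebraicDifferential.exists_casAlgD_eq_smul` shows (Schur) that the trace-form Casimir operator
`C^alg = ∑_{a,b} A(E_ab) A(E_ba)` of the differential `A = dV_λ` of the algebraic representation
`V_λ(ℂ) = S_{λ-λ_{n-1}}(ℂⁿ) ⊗ det^{λ_{n-1}}` is SOME scalar.  Here its VALUE is computed, for
`λ` dominant, by the classical argument of Goodman–Wallach, Lemma 3.3.8 (evaluate `C^alg` on a
highest weight vector, using `A(E_ab) A(E_ba) = A(E_ba) A(E_ab) + A(E_aa) - A(E_bb)`):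

* `ofPartition_coeffPartition` — the padded partition `μ = λ - λ_{n-1}` of `coeffPartition λ` read
  as a weight of `GLₙ` is `i ↦ λ_i - λ_{n-1}` (the zero entries of an antitone list are a suffix,
  `Weight.getD_filter_pos_of_pairwise`);
* `exists_weylRepCoeff_hw` — a `B`-semi-invariant vector `v ≠ 0` of `S_μ(ℂⁿ)` of weight `μ`
  (`hasHighestWeight_weylRep_ofPartition`, Fulton, *Young Tableaux*, §8.2), whence
  `coeffRepGL_apply_of_hw`: `V_λ(b) v = det(b)^{λ_{n-1}} b^μ v` for upper triangular `b`;
* `algDiff_single_apply_of_lt`, `algDiff_single_self_apply` — DIFFERENTIATING along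
  `exp(t E_ab) = 1 + t E_ab` (`a < b`) and `exp(t E_aa) = diag(1, …, e^t, …, 1)`
  (`isDifferentiableRep_alg`): `A(E_ab) v = 0` for `a < b` and `A(E_aa) v = λ_a v`;
* `casAlgD_apply_of_hw` — `C^alg v = (∑_a λ_a² + 2 ∑_a ρ_a λ_a) v` (`GLnCasimir.hwCasimirScalar`);
* **`casAlgD_eq_smul_of_isDominant`** — `C^alg = (∑_i (λ_i + ρ_i)² - ∑_i ρ_i²) · 1`,
  `ρ_i = (n-1)/2 - i`;
* **`ConeDictionary.op_σ𝔤S_apply_eq_smul`** — on the coefficient system `E_λ = ⨂_τ V_{λ_τ}(ℂ)` of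
  `Res_{K/ℚ} GLₙ` the trace-form Casimir operator of `𝔤 = 𝔤𝔩ₙ(K_∞)` acts by
  `∑_τ (∑_i (λ_{τ,i} + ρ_i)² - ∑_i ρ_i²)` (`op_σ𝔤S_apply`, `op_σT_eq`) — the `E_λ`-side input (i)
  of the Kuga-lemma proof of Clozel's Lemme 3.14/3.15 (`ResGLnCuspidalCohomologyApexKuga`).

[cite: GoodmanWallachGTM255, Lemma 3.3.8] [cite: Knapp2002, §V.4] [cite: FultonHarrisGTM129, §15.5]
[cite: BorelWallach2000, I §2.3, II §2.5]

## References

* R. Goodman, N. R. Wallach, *Symmetry, Representations, and Invariants*, GTM 255 (2009),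
  Lemma 3.3.8 (held, p. 262 of the scan). [GoodmanWallachGTM255]
* A. W. Knapp, *Lie Groups Beyond an Introduction*, 2nd ed. (2002), §V.4. [Knapp2002]
* W. Fulton, J. Harris, *Representation Theory*, GTM 129 (1991), §15.5. [FultonHarrisGTM129]
* A. Borel, N. Wallach, *Continuous cohomology, discrete subgroups, and representations of
  reductive groups*, 2nd ed. (2000), I §2.3, II §2.5. [BorelWallach2000]
-/

noncomputable section

-- Mathlib idiom (Mathlib/Algebra/Lie/OfAssociative.lean), as in `GKModules` / `GLnAlgebraicDifferential`:
-- the commutator bracket on matrix algebras and on `Module.End`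
attribute [local instance 100] LieRing.ofAssociativeRing

open scoped Matrix TensorProduct

namespace Literature.NumberTheory.Automorphic

namespace AlgDiff

open scoped Classical
open RealMatrixGroup GLnCohomology Literature.NumberTheory.DiophantineGeometry

variable (n : ℕ) (wt : Fin n → ℤ)

/-! ### The weight of `coeffPartition λ` is `λ - λ_{n-1}` -/

/-- For a dominant weight the lowest entry `λ_{n-1}` is a lower bound of the entries. [folklore] -/
theorem lowestEntry_le_apply (hwt : Weight.IsDominant wt) (i : Fin n) : lowestEntry wt ≤ wt i := by
  cases n with
  | zero => exact i.elim0
  | succ m =>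
    rw [lowestEntry_succ]
    exact hwt (Fin.le_last i)

/-- `λ_i - λ_{n-1}` as an integer. [folklore] -/
theorem polyShift_natCast (hwt : Weight.IsDominant wt) (i : Fin n) :
    ((polyShift wt i : ℕ) : ℤ) = wt i - lowestEntry wt := by
  rw [polyShift, Int.toNat_of_nonneg (sub_nonneg.2 (lowestEntry_le_apply n wt hwt i))]

/-- The shifted entries of a dominant weight are weakly decreasing. [folklore] -/
theorem polyShift_antitone (hwt : Weight.IsDominant wt) : Antitone (polyShift wt) := by
  intro i j hij
  have h : ((polyShift wt j : ℕ) : ℤ) ≤ polyShift wt i := by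
    rw [polyShift_natCast n wt hwt, polyShift_natCast n wt hwt]
    exact sub_le_sub_right (hwt hij) _
  exact_mod_cast h

/-- The sorted parts of `coeffPartition λ` are the positive shifted entries, in order. [folklore] -/
theorem sortedParts_coeffPartition (hwt : Weight.IsDominant wt) :
    (coeffPartition wt).sortedParts = (List.ofFn (polyShift wt)).filter (0 < ·) := by
  have hsorted : (List.ofFn (polyShift wt)).Pairwise (· ≥ ·) :=
    (polyShift_antitone n wt hwt).sortedGE_ofFn.pairwise
  have hparts : (coeffPartition wt).parts =
      (((List.ofFn (polyShift wt)).filter (0 < ·) : List ℕ) : Multiset ℕ) := by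
    rw [coeffPartition_parts, Fin.univ_val_map, Multiset.filter_coe]
    congr 1
    exact List.filter_congr fun x _ => by simp [Nat.pos_iff_ne_zero]
  change (coeffPartition wt).parts.sort (· ≥ ·) = _
  rw [hparts, Multiset.coe_sort]
  exact List.mergeSort_eq_self (r := (· ≥ ·)) (hsorted.filter _)

/-- **The weight of the partition `μ = λ - λ_{n-1}` of `V_λ` is `i ↦ λ_i - λ_{n-1}`** (`λ` dominant).
[cite: FultonHarrisGTM129, §15.5] -/
theorem ofPartition_coeffPartition (hwt : Weight.IsDominant wt) (i : Fin n) :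
    Weight.ofPartition n (coeffPartition wt) i = wt i - lowestEntry wt := by
  have hsorted : (List.ofFn (polyShift wt)).Pairwise (· ≥ ·) :=
    (polyShift_antitone n wt hwt).sortedGE_ofFn.pairwise
  rw [Weight.ofPartition_apply, sortedParts_coeffPartition n wt hwt,
    Weight.getD_filter_pos_of_pairwise hsorted, List.getD_eq_getElem _ _ (by simp), List.getElem_ofFn,
    ← polyShift_natCast n wt hwt]

/-! ### A highest weight vector of `V_λ(ℂ)` -/

/-- **A `B`-semi-invariant vector of `S_μ(ℂⁿ)` of weight `μ`** (`hasHighestWeight_weylRep_ofPartition`).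
[cite: FultonHarrisGTM129, Thm. 6.3 (4), §15.5] -/
theorem exists_weylRepCoeff_hw :
    ∃ v : GLnCohomology.CoeffModule ℂ n wt, v ≠ 0 ∧ ∀ g : GL (Fin n) ℂ, IsUpperTriangular g →
      weylRepCoeff ℂ n wt g v = weightChar (Weight.ofPartition n (coeffPartition wt)) g • v := by
  have h := hasHighestWeight_weylRep_ofPartition (k := ℂ) (N := n) (coeffPartition wt)
    ((ComplexPlace.card_parts_coeffPartition_le wt).trans_eq (Fintype.card_fin n))
  rw [hasHighestWeight_iff_exists] at h
  obtain ⟨v, hv0, hv⟩ := h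
  exact ⟨v, hv0, fun g hg => hv g hg⟩

variable {wt}

/-- `V_λ(b) v = det(b)^{λ_{n-1}} b^χ v` for upper triangular `b` and a `B`-semi-invariant `v` of
`S_μ` of weight `χ`. [cite: FultonHarrisGTM129, §15.5] -/
theorem coeffRepGL_apply_of_hw {v : GLnCohomology.CoeffModule ℂ n wt} {χ : Weight (Fin n)}
    (hv : ∀ g : GL (Fin n) ℂ, IsUpperTriangular g → weylRepCoeff ℂ n wt g v = weightChar χ g • v)
    {g : GL (Fin n) ℂ} (hg : IsUpperTriangular g) :
    coeffRepGL ℂ n wt g v = ((g : Matrix (Fin n) (Fin n) ℂ).det ^ lowestEntry wt * weightChar χ g) • v := by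
  rw [coeffRepGL_apply, hv g hg, smul_smul, Units.val_zpow_eq_zpow_val, Matrix.GeneralLinearGroup.val_det_apply]

/-- Upper triangularity of `g ∈ GLₙ(ℂ)` from block triangularity of its matrix (unfolding). [folklore] -/
theorem isUpperTriangular_of_blockTriangular {g : GL (Fin n) ℂ}
    (h : (g : Matrix (Fin n) (Fin n) ℂ).BlockTriangular id) : IsUpperTriangular g := h

/-! ### The one-parameter groups `exp(t E_ab)` -/

/-- `exp x = 1 + x` for `x² = 0` (as in `LeviConstantTermCenter`). [folklore] -/
private theorem exp_eq_one_add_of_mul_self_eq_zero {B : Type*} [Ring B] [Algebra ℝ B] [TopologicalSpace B]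
    [IsTopologicalRing B] [T2Space B] {x : B} (hx : x * x = 0) : NormedSpace.exp x = 1 + x := by
  rw [NormedSpace.exp_eq_tsum ℝ]
  dsimp only
  rw [tsum_eq_sum (s := Finset.range 2)]
  · simp [Finset.sum_range_succ]
  · intro m hm
    have h2 : 2 ≤ m := by rw [Finset.mem_range, not_lt] at hm; exact hm
    rw [pow_eq_zero_of_le h2 (by rw [pow_two, hx]), smul_zero]

/-- `t E_ab = E_ab(t)` over `ℂ`. [folklore] -/
theorem smul_single_one (a b : Fin n) (t : ℝ) :
    t • Matrix.single a b (1 : ℂ) = Matrix.single a b (t : ℂ) := by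
  rw [Matrix.smul_single, Complex.real_smul, mul_one]

/-- `exp(t E_ab) = 1 + t E_ab` for `a ≠ b`. [folklore] -/
theorem exp_smul_single_of_ne {a b : Fin n} (hab : a ≠ b) (t : ℝ) :
    NormedSpace.exp (t • Matrix.single a b (1 : ℂ)) = Matrix.transvection a b (t : ℂ) := by
  rw [smul_single_one, Matrix.transvection, exp_eq_one_add_of_mul_self_eq_zero]
  exact Matrix.single_mul_single_of_ne _ _ _ _ hab.symm _

/-- `exp(t E_aa) = diag(1, …, e^t, …, 1)`. [folklore] -/
theorem exp_smul_single_self (a : Fin n) (t : ℝ) :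
    NormedSpace.exp (t • Matrix.single a a (1 : ℂ)) =
      Matrix.diagonal fun i => NormedSpace.exp (Pi.single (M := fun _ => ℂ) a (t : ℂ) i) := by
  rw [smul_single_one, ← Matrix.diagonal_single, Matrix.exp_diagonal, Pi.exp_def]

/-- The diagonal of `exp(t E_aa)` off `a` is `1`. [folklore] -/
theorem exp_single_apply_of_ne {a i : Fin n} (hi : i ≠ a) (t : ℝ) :
    NormedSpace.exp (Pi.single (M := fun _ => ℂ) a (t : ℂ) i) = 1 := by
  rw [Pi.single_eq_of_ne hi, NormedSpace.exp_zero]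

/-- The diagonal entry of `exp(t E_aa)` at `a` is `e^t`. [folklore] -/
theorem exp_single_apply_self (a : Fin n) (t : ℝ) :
    NormedSpace.exp (Pi.single (M := fun _ => ℂ) a (t : ℂ) a) = Complex.exp t := by
  rw [Pi.single_eq_same, Complex.exp_eq_exp_ℂ]

/-- `V_λ(exp(t E_ab)) v = v` for `a < b` and a `B`-semi-invariant `v`. [folklore] -/
theorem coeffRepGL_expGL_single_of_lt {v : GLnCohomology.CoeffModule ℂ n wt} {χ : Weight (Fin n)}
    (hv : ∀ g : GL (Fin n) ℂ, IsUpperTriangular g → weylRepCoeff ℂ n wt g v = weightChar χ g • v)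
    {a b : Fin n} (hab : a < b) (t : ℝ) :
    coeffRepGL ℂ n wt (expGL (t • Matrix.single a b (1 : ℂ))) v = v := by
  set g : GL (Fin n) ℂ := expGL (t • Matrix.single a b (1 : ℂ)) with hgdef
  have hmat : (g : Matrix (Fin n) (Fin n) ℂ) = Matrix.transvection a b (t : ℂ) := by
    rw [hgdef, coe_expGL, exp_smul_single_of_ne n hab.ne]
  have hg : IsUpperTriangular g :=
    isUpperTriangular_of_blockTriangular n (by rw [hmat]; exact Matrix.blockTriangular_transvection hab.le _)
  have hdiag : ∀ i : Fin n, Matrix.transvection a b (t : ℂ) i i = 1 := fun i => by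
    rw [Matrix.transvection, Matrix.add_apply, Matrix.one_apply_eq, Matrix.single_apply_of_ne, add_zero]
    rintro ⟨rfl, rfl⟩
    exact hab.ne rfl
  rw [coeffRepGL_apply_of_hw n hv hg, weightChar, hmat, Matrix.det_transvection_of_ne a b hab.ne]
  simp only [hdiag, one_zpow, Finset.prod_const_one, mul_one, one_smul]

/-- `V_λ(exp(t E_aa)) v = e^{(λ_{n-1} + χ_a) t} v` for a `B`-semi-invariant `v` of `S_μ` of weight `χ`.
[folklore] -/
theorem coeffRepGL_expGL_single_self {v : GLnCohomology.CoeffModule ℂ n wt} {χ : Weight (Fin n)}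
    (hv : ∀ g : GL (Fin n) ℂ, IsUpperTriangular g → weylRepCoeff ℂ n wt g v = weightChar χ g • v)
    (a : Fin n) (t : ℝ) :
    coeffRepGL ℂ n wt (expGL (t • Matrix.single a a (1 : ℂ))) v =
      Complex.exp (((lowestEntry wt + χ a : ℤ) : ℂ) * (t : ℂ)) • v := by
  set d : Fin n → ℂ := fun i => NormedSpace.exp (Pi.single (M := fun _ => ℂ) a (t : ℂ) i) with hd
  set g : GL (Fin n) ℂ := expGL (t • Matrix.single a a (1 : ℂ)) with hgdef
  have hmat : (g : Matrix (Fin n) (Fin n) ℂ) = Matrix.diagonal d := by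
    rw [hgdef, coe_expGL, exp_smul_single_self]
  have hg : IsUpperTriangular g :=
    isUpperTriangular_of_blockTriangular n (by rw [hmat]; exact Matrix.blockTriangular_diagonal d)
  have hda : d a = Complex.exp t := exp_single_apply_self n a t
  have hdi : ∀ i, i ≠ a → d i = 1 := fun i hi => exp_single_apply_of_ne n hi t
  have hdet : (Matrix.diagonal d).det = Complex.exp t := by
    rw [Matrix.det_diagonal, Finset.prod_eq_single a (fun i _ hi => hdi i hi) (fun h => absurd (Finset.mem_univ a) h),
      hda]
  have hchar : weightChar χ g = Complex.exp t ^ χ a := by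
    rw [weightChar, hmat]
    simp only [Matrix.diagonal_apply_eq]
    rw [Finset.prod_eq_single a (fun i _ hi => by rw [hdi i hi, one_zpow]) (fun h => absurd (Finset.mem_univ a) h),
      hda]
  rw [coeffRepGL_apply_of_hw n hv hg, hchar, hmat, hdet, ← zpow_add₀ (Complex.exp_ne_zero _),
    ← Complex.exp_int_mul]

/-! ### The differential on a highest weight vector -/

/-- The weak derivative of `t ↦ V_λ(exp tX) v` at `0` is `A(X) v` (`isDifferentiableRep_alg`).
[cite: BorelWallach2000, 0 §2.3] -/
theorem hasDerivAt_coeffRepGL_expGL (X : Matrix (Fin n) (Fin n) ℂ) (v : GLnCohomology.CoeffModule ℂ n wt)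
    (ℓ : Module.Dual ℂ (GLnCohomology.CoeffModule ℂ n wt)) :
    HasDerivAt (fun t : ℝ => ℓ (coeffRepGL ℂ n wt (expGL (t • X)) v)) (ℓ (algDiff n wt X v)) 0 :=
  (isDifferentiableRep_alg n wt).hasDerivAt_coeff (toLie n X) v ℓ

/-- **`A(E_ab) v = 0` for `a < b`** and a `B`-semi-invariant `v`: `V_λ(exp(t E_ab)) v` is constant.
[cite: GoodmanWallachGTM255, Lemma 3.3.8] -/
theorem algDiff_single_apply_of_lt {v : GLnCohomology.CoeffModule ℂ n wt} {χ : Weight (Fin n)}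
    (hv : ∀ g : GL (Fin n) ℂ, IsUpperTriangular g → weylRepCoeff ℂ n wt g v = weightChar χ g • v)
    {a b : Fin n} (hab : a < b) :
    algDiff n wt (Matrix.single a b 1) v = 0 := by
  rw [← Module.forall_dual_apply_eq_zero_iff ℂ]
  intro ℓ
  have h1 := hasDerivAt_coeffRepGL_expGL n (Matrix.single a b (1 : ℂ)) v ℓ
  simp only [coeffRepGL_expGL_single_of_lt n hv hab] at h1
  exact h1.unique (hasDerivAt_const (0 : ℝ) (ℓ v))

/-- **`A(E_aa) v = (λ_{n-1} + χ_a) v`** for a `B`-semi-invariant `v` of `S_μ` of weight `χ`: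
differentiate `V_λ(exp(t E_aa)) v = e^{(λ_{n-1} + χ_a) t} v`. [cite: GoodmanWallachGTM255, Lemma 3.3.8] -/
theorem algDiff_single_self_apply {v : GLnCohomology.CoeffModule ℂ n wt} {χ : Weight (Fin n)}
    (hv : ∀ g : GL (Fin n) ℂ, IsUpperTriangular g → weylRepCoeff ℂ n wt g v = weightChar χ g • v)
    (a : Fin n) :
    algDiff n wt (Matrix.single a a 1) v = (((lowestEntry wt + χ a : ℤ) : ℂ)) • v := by
  set m : ℂ := ((lowestEntry wt + χ a : ℤ) : ℂ) with hm
  rw [← sub_eq_zero, ← Module.forall_dual_apply_eq_zero_iff ℂ]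
  intro ℓ
  have h1 := hasDerivAt_coeffRepGL_expGL n (Matrix.single a a (1 : ℂ)) v ℓ
  simp only [coeffRepGL_expGL_single_self n hv a, map_smul, smul_eq_mul] at h1
  have h3 : HasDerivAt (fun y : ℝ => (y : ℂ)) 1 0 := by
    have h := (hasDerivAt_id (0 : ℝ)).ofReal_comp
    rw [Complex.ofReal_one] at h
    exact h
  have h2 : HasDerivAt (fun t : ℝ => Complex.exp (m * (t : ℂ)) * ℓ v) (m * ℓ v) 0 := by
    have h := ((h3.const_mul m).cexp).mul_const (ℓ v)
    rw [Complex.ofReal_zero, mul_zero, Complex.exp_zero, one_mul, mul_one] at h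
    exact h
  rw [map_sub, map_smul, smul_eq_mul, h1.unique h2, sub_self]

/-! ### The Casimir operator on a highest weight vector -/

/-- `A(E_ab) A(E_ba) = A(E_ba) A(E_ab) + (A(E_aa) - A(E_bb))` (`A` is a morphism of Lie algebras,
`[E_ab, E_ba] = E_aa - E_bb`). [cite: GoodmanWallachGTM255, Lemma 3.3.8 (3.39)] -/
theorem algDiff_single_mul_single (a b : Fin n) :
    algDiff n wt (Matrix.single a b 1) * algDiff n wt (Matrix.single b a 1) =
      algDiff n wt (Matrix.single b a 1) * algDiff n wt (Matrix.single a b 1) +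
        (algDiff n wt (Matrix.single a a 1) - algDiff n wt (Matrix.single b b 1)) := by
  have h := (algDiff n wt).map_lie (Matrix.single a b (1 : ℂ)) (Matrix.single b a 1)
  rw [Ring.lie_def, Ring.lie_def, Matrix.single_mul_single_same, Matrix.single_mul_single_same, mul_one,
    map_sub] at h
  rw [h]
  abel

/-- **`C^alg v = (∑_a f_a² + 2 ∑_a ρ_a f_a) v`** for a vector killed by the `A(E_ab)`, `a < b`, on which
`A(E_aa)` acts by `f_a`. [cite: GoodmanWallachGTM255, Lemma 3.3.8] -/
theorem casAlgD_apply_of_hw {v : GLnCohomology.CoeffModule ℂ n wt} {f : Fin n → ℂ}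
    (h0 : ∀ a b : Fin n, a < b → algDiff n wt (Matrix.single a b 1) v = 0)
    (h1 : ∀ a : Fin n, algDiff n wt (Matrix.single a a 1) v = f a • v) :
    casAlgD n wt v = (∑ a, f a ^ 2 + 2 * ∑ a, rhoGL n a * f a) • v := by
  have hterm : ∀ a b : Fin n, algDiff n wt (Matrix.single a b 1) (algDiff n wt (Matrix.single b a 1) v) =
      ((if a = b then f a ^ 2 else (0 : ℂ)) + (if a < b then f a - f b else (0 : ℂ))) • v := by
    intro a b
    rcases lt_trichotomy a b with hab | rfl | hba
    · have h := LinearMap.congr_fun (algDiff_single_mul_single n (wt := wt) a b) v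
      rw [Module.End.mul_apply] at h
      rw [h, LinearMap.add_apply, Module.End.mul_apply, h0 a b hab, map_zero, zero_add, LinearMap.sub_apply,
        h1, h1, if_neg hab.ne, if_pos hab, zero_add, sub_smul]
    · rw [h1, map_smul, h1, smul_smul, if_pos rfl, if_neg (lt_irrefl a), add_zero, sq]
    · rw [h0 b a hba, map_zero, if_neg hba.ne', if_neg (not_lt.2 hba.le), add_zero, zero_smul]
  simp only [casAlgD, LinearMap.sum_apply, Module.End.mul_apply, hterm, ← Finset.sum_smul]
  rw [GLnCasimir.hwCasimirScalar]

/-- `∑_a f_a² + 2 ∑_a ρ_a f_a = ∑_a (f_a + ρ_a)² - ∑_a ρ_a²`. [folklore] -/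
theorem sum_sq_add_two_mul_sum_rho (f : Fin n → ℂ) :
    ∑ a, f a ^ 2 + 2 * ∑ a, rhoGL n a * f a = ∑ a, (f a + rhoGL n a) ^ 2 - ∑ a, rhoGL n a ^ 2 := by
  have h := GLnCasimir.hwCasimirScalar_sub_rho (n := n) (fun a => f a + rhoGL n a)
  simp only [add_sub_cancel_right] at h
  exact h

variable (wt)

/-- **The Casimir scalar of `V_λ(ℂ)`: `C^alg = (∑_i (λ_i + ρ_i)² - ∑_i ρ_i²) · 1` for `λ` dominant**,
`ρ_i = (n-1)/2 - i` (Goodman–Wallach, Lemma 3.3.8, for `𝔤𝔩ₙ` and the trace form: `C^alg` is a scalar by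
Schur, and on the highest weight vector of `V_λ = S_{λ-λ_{n-1}}(ℂⁿ) ⊗ det^{λ_{n-1}}`, of weight `λ`, it is
`∑_a λ_a² + ∑_{a<b} (λ_a - λ_b)`). [cite: GoodmanWallachGTM255, Lemma 3.3.8] [cite: Knapp2002, §V.4] -/
theorem casAlgD_eq_smul_of_isDominant (hwt : Weight.IsDominant wt) :
    casAlgD n wt = (∑ i, ((wt i : ℂ) + rhoGL n i) ^ 2 - ∑ i, rhoGL n i ^ 2) •
      (1 : Module.End ℂ (GLnCohomology.CoeffModule ℂ n wt)) := by
  obtain ⟨c, hc⟩ := exists_casAlgD_eq_smul n wt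
  obtain ⟨v, hv0, hv⟩ := exists_weylRepCoeff_hw n wt
  have hL0 : ∀ a b : Fin n, a < b → algDiff n wt (Matrix.single a b 1) v = 0 := fun a b hab =>
    algDiff_single_apply_of_lt n hv hab
  have hL1 : ∀ a : Fin n, algDiff n wt (Matrix.single a a 1) v = (wt a : ℂ) • v := fun a => by
    rw [algDiff_single_self_apply n hv a, ofPartition_coeffPartition n wt hwt a, add_sub_cancel]
  have h := casAlgD_apply_of_hw n hL0 hL1
  rw [hc, LinearMap.smul_apply, Module.End.one_apply, sum_sq_add_two_mul_sum_rho] at h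
  rw [hc, smul_left_injective ℂ hv0 h]

end AlgDiff

/-! ### The Casimir scalar of the coefficient system `E_λ` of `Res_{K/ℚ} GLₙ` -/

namespace ConeDictionary

-- `Classical`: the place subtypes indexing `mixedSpace K` are `Fintype` classically (as in `AdelicGLnGlue`).
open scoped Classical
open _root_.NumberField RealMatrixGroup Literature.NumberTheory.DiophantineGeometry

variable (n : ℕ) (K : Type) [Field K] [NumberField K] (hcpt : isCompact_glFiniteIntegralLevel n K)
  (lam : (K →+* ℂ) → Fin n → ℤ)

/-- **The trace-form Casimir operator acts on `E_λ` by `∑_τ (∑_i (λ_{τ,i} + ρ_i)² - ∑_i ρ_i²)`** for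
`λ` dominant: `C_E = ∑_τ 1 ⊗ ⋯ ⊗ C^alg_{λ_τ} ⊗ ⋯ ⊗ 1` (`op_σT_eq`) and `casAlgD_eq_smul_of_isDominant`.
This is the VALUE of the scalar of `exists_op_σ𝔤S_eq_smul`. [cite: BorelWallach2000, I §2.3, II §2.5]
[cite: GoodmanWallachGTM255, Lemma 3.3.8] -/
theorem op_σ𝔤S_apply_eq_smul (hdom : ∀ τ, Weight.IsDominant (lam τ)) (e : ResGLnCohomology.CoeffModule ℂ n K lam) :
    GKCasimir.op (AutomorphyDatum.gl n K hcpt).arch (σ𝔤S hcpt lam) (bD n K hcpt) (dD n K hcpt) e =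
      (∑ τ : K →+* ℂ, (∑ i, ((lam τ i : ℂ) + rhoGL n i) ^ 2 - ∑ i, rhoGL n i ^ 2)) • e := by
  have hc : ∀ τ : K →+* ℂ, AlgDiff.casAlgD n (lam τ) =
      (∑ i, ((lam τ i : ℂ) + rhoGL n i) ^ 2 - ∑ i, rhoGL n i ^ 2) •
        (1 : Module.End ℂ (GLnCohomology.CoeffModule ℂ n (lam τ))) :=
    fun τ => AlgDiff.casAlgD_eq_smul_of_isDominant n (lam τ) (hdom τ)
  rw [op_σ𝔤S_apply, op_σT_eq]
  simp only [hc, PiTensor.slot_smul, ComplexPlace.slot_one']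
  rw [LinearMap.sum_apply, Finset.sum_smul]
  rfl

end ConeDictionary

end Literature.NumberTheory.Automorphic

end
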